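import Summits.CriticalPhenomena.SAWScalingLimit.Theorems.SAWLoopFugacityFlowAvoidanceLimitAnchorDefs
import Literature.Probability.RandomPlanarGeometry.FaceGreenFunction
import Mathlib.Topology.Algebra.InfiniteSum.Real

/-!
# The killed-SRW Green's function `greenEntry`: Neumann series, invertibility, positivity, monotonicity
— helper file 1 of stub `stub_excursionRatio` of line `symplectic-fermion-anchor`
(crux `SAWLoopFugacityFlow.AvoidanceLimit`, stmt-CriticalPhenomena-10649)

For a subgraph `H ≤ ℤ²` and a finite volume `Λ`, let `P = ¼·A_{H|Λ}` (`(4 : ℝ)⁻¹ • adjMat H Λ`) be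
the substochastic transition matrix of the simple random walk on `ℤ²` killed when it attempts a
step that is not an edge of `H|_Λ`. We prove, adapting the tree's treatment of the face walk
(`Literature/Probability/RandomPlanarGeometry/FaceGreenFunction.lean`, induced subgraphs of `ℤ²`)
to arbitrary sub-graphs `H ≤ zdGraph 2` (edges may be deleted as well as vertices — the case of
`discreteDomainGraph Ω δ` and of the line's `confinedGraph Ω S δ`):

* `sum_range_transition_pow_apply_le`, `summable_transition_pow_apply` — `Σ_n (Pⁿ)_{xy} < ∞`, by
  the supersolution `w(x) = M² − x₀²`, `P w ≤ w − ½` (dropping the nonnegative terms of the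
  deleted edges only helps);
* `one_sub_transition_mul_tsum`, `isUnit_one_sub_transition`, `inv_one_sub_transition` —
  **`(1 − P) Σ_n Pⁿ = 1`**, so `1 − ¼A` IS invertible on every finite piece of `ℤ²` and Mathlib's
  `⁻¹` in `greenEntry` is the genuine inverse `Σ_n Pⁿ` (no junk);
* `greenEntry_eq_tsum` (`G = Σ_n (Pⁿ)_{ab}`, the walk sum `Σ_{walks a → b of H|Λ} 4^{-|w|}` grouped
  by length), `greenEntry_nonneg`, `greenEntry_comm`, `greenEntry_mono` (monotone in `H`),
  `greenEntry_pos` (positive between vertices joined in `H` inside `Λ`);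
* `greenRatio_nonneg`, `greenRatio_le_one`, and the registered closing theorem
  `greenRatio_mem_Icc : greenRatio Ω S δ a b ∈ [0, 1]` (confined walks are a subset of all walks).

Sources: G. F. Lawler, *Intersections of Random Walks* (1991), §1.5 (Green's function of the killed
walk as a path sum, finiteness, symmetry) [Lawler1991]; G. F. Lawler, V. Limic, *Random Walk: A
Modern Introduction* (2010), §4.6 [LawlerLimic2010]; folklore linear algebra. No definitions.
-/

noncomputable section

open scoped BigOperators Topology symmDiff Classical
open Filter Finset Matrix
open Literature.Probability.RandomPlanarGeometry Literature.Probability.LatticeModels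

namespace Summit.CriticalPhenomena.SAWScalingLimit.Theorems.AvoidanceLimit.Anchor

namespace KilledGreen

variable (H : SimpleGraph (Site 2)) (Λ : Finset (Site 2))

/-! ## The transition matrix `P = ¼ A_{H|Λ}` and its powers -/

/-- Entries of the adjacency matrix: `1` between `H`-adjacent vertices of `Λ`, `0` otherwise.
[folklore] -/
theorem adjMat_apply' (x y : Λ) : adjMat H Λ x y = if H.Adj x.1 y.1 then 1 else 0 := rfl

/-- Entries of `P = ¼A`: `¼` between `H`-adjacent vertices of `Λ`, `0` otherwise. [folklore] -/
theorem transition_apply (x y : Λ) :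
    ((4 : ℝ)⁻¹ • adjMat H Λ) x y = if H.Adj x.1 y.1 then (4 : ℝ)⁻¹ else 0 := by
  rw [Matrix.smul_apply, adjMat_apply', smul_eq_mul, mul_ite, mul_one, mul_zero]

/-- Entries of `P` are nonnegative. [folklore] -/
theorem transition_apply_nonneg (x y : Λ) : 0 ≤ ((4 : ℝ)⁻¹ • adjMat H Λ) x y := by
  rw [transition_apply]
  split_ifs <;> norm_num

/-- Entries of `P` are at most `¼`. [folklore] -/
theorem transition_apply_le (x y : Λ) : ((4 : ℝ)⁻¹ • adjMat H Λ) x y ≤ (4 : ℝ)⁻¹ := by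
  rw [transition_apply]
  split_ifs <;> norm_num

/-- `P` is symmetric. [folklore] -/
theorem transition_comm (x y : Λ) :
    ((4 : ℝ)⁻¹ • adjMat H Λ) x y = ((4 : ℝ)⁻¹ • adjMat H Λ) y x := by
  rw [transition_apply, transition_apply]
  exact if_congr (H.adj_comm _ _) rfl rfl

/-- Entries of `Pⁿ` are nonnegative. [folklore] -/
theorem transition_pow_apply_nonneg (n : ℕ) (x y : Λ) :
    0 ≤ (((4 : ℝ)⁻¹ • adjMat H Λ) ^ n) x y := by
  induction n generalizing x y with
  | zero =>
      rw [pow_zero, Matrix.one_apply]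
      split_ifs <;> norm_num
  | succ n ih =>
      rw [pow_succ, Matrix.mul_apply]
      exact Finset.sum_nonneg fun z _ => mul_nonneg (ih x z) (transition_apply_nonneg H Λ z y)

/-- `P` is a symmetric matrix. [folklore] -/
theorem transition_transpose : ((4 : ℝ)⁻¹ • adjMat H Λ)ᵀ = (4 : ℝ)⁻¹ • adjMat H Λ := by
  ext x y
  rw [Matrix.transpose_apply]
  exact transition_comm H Λ y x

/-- `Pⁿ` is symmetric (`P` is). [folklore] -/
theorem transition_pow_comm (n : ℕ) (x y : Λ) :
    (((4 : ℝ)⁻¹ • adjMat H Λ) ^ n) x y = (((4 : ℝ)⁻¹ • adjMat H Λ) ^ n) y x := by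
  conv_rhs => rw [← transition_transpose H Λ, ← Matrix.transpose_pow, Matrix.transpose_apply]

/-- `P` is entrywise nonnegative, hence monotone as an operator. [folklore] -/
theorem transition_mulVec_mono {u v : Λ → ℝ} (h : u ≤ v) :
    ((4 : ℝ)⁻¹ • adjMat H Λ) *ᵥ u ≤ ((4 : ℝ)⁻¹ • adjMat H Λ) *ᵥ v := by
  intro x
  simp only [Matrix.mulVec, dotProduct]
  exact Finset.sum_le_sum fun y _ =>
    mul_le_mul_of_nonneg_left (h y) (transition_apply_nonneg H Λ x y)

/-- `(P u)(x) = ¼ Σ_{y ∈ Λ, y ∼_H x} u(y)`. [folklore] -/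
theorem transition_mulVec_apply (u : Λ → ℝ) (x : Λ) :
    (((4 : ℝ)⁻¹ • adjMat H Λ) *ᵥ u) x =
      (4 : ℝ)⁻¹ * ∑ y ∈ univ.filter (fun y : Λ => H.Adj x.1 y.1), u y := by
  rw [Finset.mul_sum, Finset.sum_filter]
  simp only [Matrix.mulVec, dotProduct, transition_apply, ite_mul, zero_mul]

/-! ## Supersolution and summability of the Neumann series (`H ≤ ℤ²`) -/

variable {H}

/-- The `H`-neighbours in `Λ` of `x` are among its four lattice neighbours (`H ≤ ℤ²`). [folklore] -/
theorem map_filter_adj_subset (hH : H ≤ zdGraph 2) (x : Λ) :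
    (univ.filter (fun y : Λ => H.Adj x.1 y.1)).map (Function.Embedding.subtype _) ⊆
      (zdGraph 2).neighborFinset x.1 := by
  intro z hz
  rw [Finset.mem_map] at hz
  obtain ⟨y, hy, rfl⟩ := hz
  rw [Finset.mem_filter] at hy
  rw [SimpleGraph.mem_neighborFinset]
  exact hH hy.2

/-- **Supersolution inequality** `P w ≤ w − ½` on `Λ` for `w(x) = M² − x₀²`,
`M = 1 + Σ_{z ∈ Λ} |z₀|`: averaging `M² − z₀²` over the four lattice neighbours of `x` gives exactly
`M² − x₀² − ½`, and dropping the (nonnegative) terms of the neighbours not joined to `x` in `H|_Λ`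
only decreases the sum (cf. `faceTransition_mulVec_facePotential_le`). [folklore] -/
theorem transition_mulVec_potential_le (hH : H ≤ zdGraph 2) (x : Λ) :
    (((4 : ℝ)⁻¹ • adjMat H Λ) *ᵥ fun y : Λ =>
        ((∑ z ∈ Λ, |((z 0 : ℤ) : ℝ)|) + 1) ^ 2 - (((y : Site 2) 0 : ℤ) : ℝ) ^ 2) x ≤
      (((∑ z ∈ Λ, |((z 0 : ℤ) : ℝ)|) + 1) ^ 2 - (((x : Site 2) 0 : ℤ) : ℝ) ^ 2) - 2⁻¹ := by
  set M : ℝ := (∑ z ∈ Λ, |((z 0 : ℤ) : ℝ)|) + 1 with hM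
  set wt : Site 2 → ℝ := fun z => M ^ 2 - ((z 0 : ℤ) : ℝ) ^ 2 with hwt
  have hxM : |(((x : Site 2) 0 : ℤ) : ℝ)| + 1 ≤ M := by
    have := Finset.single_le_sum (f := fun z : Site 2 => |((z 0 : ℤ) : ℝ)|)
      (fun z _ => abs_nonneg _) x.2
    simp only [hM]
    linarith
  -- nonnegativity of the potential on the lattice neighbours of `x`
  have hnn : ∀ z ∈ (zdGraph 2).neighborFinset (x : Site 2), 0 ≤ wt z := by
    intro z hz
    rw [neighborFinset_zdGraph_eq_image, Finset.mem_image] at hz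
    obtain ⟨p, -, rfl⟩ := hz
    set s : Site 2 := Pi.single p.1 (if p.2 then 1 else -1) with hs
    have hb : |((s 0 : ℤ) : ℝ)| ≤ 1 := by
      rcases p with ⟨i, b⟩
      fin_cases i <;> cases b <;> simp [hs]
    have hz0 : |((((x : Site 2) + s) 0 : ℤ) : ℝ)| ≤ M :=
      calc |((((x : Site 2) + s) 0 : ℤ) : ℝ)| = |(((x : Site 2) 0 : ℤ) : ℝ) + ((s 0 : ℤ) : ℝ)| := by
            simp [Pi.add_apply, Int.cast_add]
        _ ≤ |(((x : Site 2) 0 : ℤ) : ℝ)| + 1 := (abs_add_le _ _).trans (by linarith)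
        _ ≤ M := hxM
    have hsq : ((((x : Site 2) + s) 0 : ℤ) : ℝ) ^ 2 ≤ M ^ 2 := by
      rw [← sq_abs, ← sq_abs M]
      exact pow_le_pow_left₀ (abs_nonneg _) (hz0.trans (le_abs_self M)) 2
    simp only [hwt]
    linarith
  rw [transition_mulVec_apply]
  have h1 : ∑ y ∈ univ.filter (fun y : Λ => H.Adj x.1 y.1),
      (M ^ 2 - (((y : Site 2) 0 : ℤ) : ℝ) ^ 2) =
      ∑ z ∈ (univ.filter (fun y : Λ => H.Adj x.1 y.1)).map (Function.Embedding.subtype _), wt z := by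
    rw [Finset.sum_map]
    rfl
  have h2 : ∑ z ∈ (univ.filter (fun y : Λ => H.Adj x.1 y.1)).map (Function.Embedding.subtype _), wt z
      ≤ ∑ z ∈ (zdGraph 2).neighborFinset (x : Site 2), wt z :=
    Finset.sum_le_sum_of_subset_of_nonneg (map_filter_adj_subset Λ hH x) fun z hz _ => hnn z hz
  have h3 : ∑ z ∈ (zdGraph 2).neighborFinset (x : Site 2), wt z =
      4 * M ^ 2 - 4 * (((x : Site 2) 0 : ℤ) : ℝ) ^ 2 - 2 := by
    rw [sum_neighborFinset_zdGraph_two]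
    simp only [hwt, Pi.add_apply, Pi.single_apply, Int.cast_add, Int.cast_one, Int.cast_neg,
      Int.cast_zero, if_true, Fin.zero_eq_one_iff, OfNat.ofNat_ne_one, if_false]
    ring
  have h4 := h1.trans_le (h2.trans_eq h3)
  nlinarith [h4]

/-- **Uniform bound on the partial sums of the Neumann series**, `Σ_{n<N} Pⁿ 𝟙 ≤ 2w`, by induction
on `N` from the supersolution inequality and the monotonicity of `P`: the expected number of steps
the killed walk spends in `Λ` is at most `2M²`. [folklore] -/
theorem sum_range_pow_mulVec_one_le (hH : H ≤ zdGraph 2) (N : ℕ) (x : Λ) :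
    ((∑ n ∈ Finset.range N, ((4 : ℝ)⁻¹ • adjMat H Λ) ^ n) *ᵥ fun _ => (1 : ℝ)) x ≤
      2 * (((∑ z ∈ Λ, |((z 0 : ℤ) : ℝ)|) + 1) ^ 2 - (((x : Site 2) 0 : ℤ) : ℝ) ^ 2) := by
  induction N generalizing x with
  | zero =>
      simp only [Finset.range_zero, Finset.sum_empty, Matrix.zero_mulVec, Pi.zero_apply]
      have h1 : |(((x : Site 2) 0 : ℤ) : ℝ)| ≤ ∑ z ∈ Λ, |((z 0 : ℤ) : ℝ)| :=
        Finset.single_le_sum (f := fun z : Site 2 => |((z 0 : ℤ) : ℝ)|) (fun z _ => abs_nonneg _) x.2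
      nlinarith [sq_abs (((x : Site 2) 0 : ℤ) : ℝ), abs_nonneg (((x : Site 2) 0 : ℤ) : ℝ)]
  | succ N ih =>
      have hsplit : (∑ n ∈ Finset.range (N + 1), ((4 : ℝ)⁻¹ • adjMat H Λ) ^ n) =
          ((4 : ℝ)⁻¹ • adjMat H Λ) * (∑ n ∈ Finset.range N, ((4 : ℝ)⁻¹ • adjMat H Λ) ^ n) + 1 := by
        rw [Finset.sum_range_succ', pow_zero, Finset.mul_sum]
        simp only [pow_succ']
      rw [hsplit, Matrix.add_mulVec, Matrix.one_mulVec, ← Matrix.mulVec_mulVec, Pi.add_apply]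
      have hmono := transition_mulVec_mono H Λ
        (u := (∑ n ∈ Finset.range N, ((4 : ℝ)⁻¹ • adjMat H Λ) ^ n) *ᵥ fun _ => (1 : ℝ))
        (v := (2 : ℝ) • fun y : Λ =>
          ((∑ z ∈ Λ, |((z 0 : ℤ) : ℝ)|) + 1) ^ 2 - (((y : Site 2) 0 : ℤ) : ℝ) ^ 2)
        (fun y => by simpa using ih y) x
      have hpot := transition_mulVec_potential_le Λ hH x
      rw [Matrix.mulVec_smul, Pi.smul_apply, smul_eq_mul] at hmono
      linarith

/-- Entrywise bound on the partial sums: `Σ_{n<N} (Pⁿ)_{xy} ≤ 2M²`. [folklore] -/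
theorem sum_range_transition_pow_apply_le (hH : H ≤ zdGraph 2) (N : ℕ) (x y : Λ) :
    ∑ n ∈ Finset.range N, (((4 : ℝ)⁻¹ • adjMat H Λ) ^ n) x y ≤
      2 * ((∑ z ∈ Λ, |((z 0 : ℤ) : ℝ)|) + 1) ^ 2 := by
  have h1 : ∑ n ∈ Finset.range N, (((4 : ℝ)⁻¹ • adjMat H Λ) ^ n) x y =
      (∑ n ∈ Finset.range N, ((4 : ℝ)⁻¹ • adjMat H Λ) ^ n) x y :=
    (Matrix.sum_apply x y _ _).symm
  have h2 : (∑ n ∈ Finset.range N, ((4 : ℝ)⁻¹ • adjMat H Λ) ^ n) x y ≤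
      ((∑ n ∈ Finset.range N, ((4 : ℝ)⁻¹ • adjMat H Λ) ^ n) *ᵥ fun _ => (1 : ℝ)) x := by
    simp only [Matrix.mulVec, dotProduct, mul_one]
    refine Finset.single_le_sum
      (f := fun y' => (∑ n ∈ Finset.range N, ((4 : ℝ)⁻¹ • adjMat H Λ) ^ n) x y') ?_ (Finset.mem_univ y)
    intro y' _
    rw [Matrix.sum_apply]
    exact Finset.sum_nonneg fun n _ => transition_pow_apply_nonneg H Λ n x y'
  have h3 := sum_range_pow_mulVec_one_le Λ hH N x
  nlinarith [sq_nonneg (((x : Site 2) 0 : ℤ) : ℝ)]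

/-- **Summability of the Neumann series** `Σ_n (Pⁿ)_{xy}` on a finite piece of `ℤ²` (the killed
walk leaves `Λ` almost surely, with finite expected exit time). [cite: Lawler1991, §1.5] -/
theorem summable_transition_pow_apply (hH : H ≤ zdGraph 2) (x y : Λ) :
    Summable fun n : ℕ => (((4 : ℝ)⁻¹ • adjMat H Λ) ^ n) x y :=
  summable_of_sum_range_le (fun n => transition_pow_apply_nonneg H Λ n x y)
    (fun N => sum_range_transition_pow_apply_le Λ hH N x y)

/-- **Neumann series / first-step identity**: `(1 − P) · Σ_n Pⁿ = 1`. [folklore] -/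
theorem one_sub_transition_mul_tsum (hH : H ≤ zdGraph 2) :
    ((1 : Matrix Λ Λ ℝ) - (4 : ℝ)⁻¹ • adjMat H Λ) *
      (Matrix.of fun x y : Λ => ∑' n : ℕ, (((4 : ℝ)⁻¹ • adjMat H Λ) ^ n) x y) = 1 := by
  ext x y
  have key : ∑' n : ℕ, (((4 : ℝ)⁻¹ • adjMat H Λ) ^ n) x y = (1 : Matrix Λ Λ ℝ) x y +
      ∑ z, ((4 : ℝ)⁻¹ • adjMat H Λ) x z * ∑' n : ℕ, (((4 : ℝ)⁻¹ • adjMat H Λ) ^ n) z y := by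
    rw [(summable_transition_pow_apply Λ hH x y).tsum_eq_zero_add, pow_zero]
    congr 1
    have h1 : ∀ n : ℕ, (((4 : ℝ)⁻¹ • adjMat H Λ) ^ (n + 1)) x y =
        ∑ z, ((4 : ℝ)⁻¹ • adjMat H Λ) x z * (((4 : ℝ)⁻¹ • adjMat H Λ) ^ n) z y := fun n => by
      rw [pow_succ', Matrix.mul_apply]
    calc ∑' n : ℕ, (((4 : ℝ)⁻¹ • adjMat H Λ) ^ (n + 1)) x y
        = ∑' n : ℕ, ∑ z, ((4 : ℝ)⁻¹ • adjMat H Λ) x z * (((4 : ℝ)⁻¹ • adjMat H Λ) ^ n) z y :=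
          tsum_congr h1
      _ = ∑ z, ∑' n : ℕ, ((4 : ℝ)⁻¹ • adjMat H Λ) x z * (((4 : ℝ)⁻¹ • adjMat H Λ) ^ n) z y :=
          Summable.tsum_finsetSum
            (f := fun z (n : ℕ) => ((4 : ℝ)⁻¹ • adjMat H Λ) x z * (((4 : ℝ)⁻¹ • adjMat H Λ) ^ n) z y)
            (fun z _ => (summable_transition_pow_apply Λ hH z y).mul_left _)
      _ = ∑ z, ((4 : ℝ)⁻¹ • adjMat H Λ) x z * ∑' n : ℕ, (((4 : ℝ)⁻¹ • adjMat H Λ) ^ n) z y :=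
          Finset.sum_congr rfl fun z _ => (summable_transition_pow_apply Λ hH z y).tsum_mul_left _
  rw [Matrix.sub_mul, Matrix.one_mul, Matrix.sub_apply, Matrix.of_apply, Matrix.mul_apply]
  simp only [Matrix.of_apply]
  linarith

/-- **`1 − ¼A_{H|Λ}` is invertible** on every finite piece of `ℤ²` (so Mathlib's `⁻¹` in
`greenEntry` is a genuine inverse). [folklore] -/
theorem isUnit_one_sub_transition (hH : H ≤ zdGraph 2) :
    IsUnit ((1 : Matrix Λ Λ ℝ) - (4 : ℝ)⁻¹ • adjMat H Λ) :=
  (Matrix.isUnit_iff_isUnit_det _).2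
    (Matrix.isUnit_det_of_right_inverse (one_sub_transition_mul_tsum Λ hH))

/-- `det (1 − ¼A_{H|Λ}) ≠ 0`. [folklore] -/
theorem det_one_sub_transition_ne_zero (hH : H ≤ zdGraph 2) :
    ((1 : Matrix Λ Λ ℝ) - (4 : ℝ)⁻¹ • adjMat H Λ).det ≠ 0 :=
  ((Matrix.isUnit_iff_isUnit_det _).1 (isUnit_one_sub_transition Λ hH)).ne_zero

/-- **`(1 − P)⁻¹ = Σ_n Pⁿ`** (Neumann series). [folklore] -/
theorem inv_one_sub_transition (hH : H ≤ zdGraph 2) :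
    ((1 : Matrix Λ Λ ℝ) - (4 : ℝ)⁻¹ • adjMat H Λ)⁻¹ =
      Matrix.of fun x y : Λ => ∑' n : ℕ, (((4 : ℝ)⁻¹ • adjMat H Λ) ^ n) x y :=
  Matrix.inv_eq_right_inv (one_sub_transition_mul_tsum Λ hH)

/-! ## Monotonicity in the graph and a lower bound along a walk -/

/-- Entrywise monotonicity of `Pⁿ` in the graph: fewer edges, fewer walks. [folklore] -/
theorem transition_pow_apply_mono {H' : SimpleGraph (Site 2)} (hH' : H' ≤ H) (n : ℕ) (x y : Λ) :
    (((4 : ℝ)⁻¹ • adjMat H' Λ) ^ n) x y ≤ (((4 : ℝ)⁻¹ • adjMat H Λ) ^ n) x y := by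
  induction n generalizing x y with
  | zero => rw [pow_zero, pow_zero]
  | succ n ih =>
      rw [pow_succ, Matrix.mul_apply, pow_succ, Matrix.mul_apply]
      refine Finset.sum_le_sum fun z _ => mul_le_mul (ih x z) ?_
        (transition_apply_nonneg H' Λ z y) (transition_pow_apply_nonneg H Λ n x z)
      rw [transition_apply, transition_apply]
      by_cases h : H'.Adj z.1 y.1
      · rw [if_pos h, if_pos (hH' h)]
      · rw [if_neg h]
        split_ifs <;> norm_num

/-- Along an `H`-walk from `x` to `y` of length `n` all of whose vertices lie in `Λ`,
`(Pⁿ)_{xy} ≥ 4⁻ⁿ` (the walk itself is one of the walks counted by `(Pⁿ)_{xy}`). [folklore] -/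
theorem pow_inv_four_le_transition_pow_apply {a b : Site 2} (p : H.Walk a b)
    (hp : ∀ v ∈ p.support, v ∈ Λ) (ha : a ∈ Λ) (hb : b ∈ Λ) :
    ((4 : ℝ)⁻¹) ^ p.length ≤ (((4 : ℝ)⁻¹ • adjMat H Λ) ^ p.length) ⟨a, ha⟩ ⟨b, hb⟩ := by
  induction p with
  | nil => simp
  | @cons u v w huv q ih =>
      have hv : v ∈ Λ := hp v (by simp)
      have hq : ∀ z ∈ q.support, z ∈ Λ := fun z hz => hp z (by simp [hz])
      rw [SimpleGraph.Walk.length_cons, pow_succ', pow_succ', Matrix.mul_apply]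
      calc (4 : ℝ)⁻¹ * ((4 : ℝ)⁻¹) ^ q.length
          ≤ ((4 : ℝ)⁻¹ • adjMat H Λ) ⟨u, ha⟩ ⟨v, hv⟩ *
              (((4 : ℝ)⁻¹ • adjMat H Λ) ^ q.length) ⟨v, hv⟩ ⟨w, hb⟩ := by
            rw [transition_apply, if_pos huv]
            exact mul_le_mul_of_nonneg_left (ih hq hv hb) (by norm_num)
        _ ≤ ∑ z, ((4 : ℝ)⁻¹ • adjMat H Λ) ⟨u, ha⟩ z *
              (((4 : ℝ)⁻¹ • adjMat H Λ) ^ q.length) z ⟨w, hb⟩ :=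
            Finset.single_le_sum (f := fun z => ((4 : ℝ)⁻¹ • adjMat H Λ) ⟨u, ha⟩ z *
              (((4 : ℝ)⁻¹ • adjMat H Λ) ^ q.length) z ⟨w, hb⟩)
              (fun z _ => mul_nonneg (transition_apply_nonneg H Λ _ z)
                (transition_pow_apply_nonneg H Λ _ z _)) (Finset.mem_univ _)

end KilledGreen

/-! ## Consequences for `greenEntry` and `greenRatio` -/

open KilledGreen

/-- **The Green's function is the Neumann series**: for `H ≤ ℤ²` and `a, b ∈ Λ`,
`greenEntry H Λ a b = Σ_n (Pⁿ)_{ab}`, `P = ¼A_{H|Λ}` — i.e. `Σ_{walks a → b of H|Λ} 4^{-|w|}`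
grouped by length (Lawler's `G_A(x,y) = Σ_j P^x{S_j = y, τ > j}`). [cite: Lawler1991, §1.5] -/
theorem greenEntry_eq_tsum {H : SimpleGraph (Site 2)} (hH : H ≤ zdGraph 2) {Λ : Finset (Site 2)}
    {a b : Site 2} (ha : a ∈ Λ) (hb : b ∈ Λ) :
    greenEntry H Λ a b = ∑' n : ℕ, (((4 : ℝ)⁻¹ • adjMat H Λ) ^ n) ⟨a, ha⟩ ⟨b, hb⟩ := by
  rw [greenEntry, dif_pos ⟨ha, hb⟩, inv_one_sub_transition Λ hH, Matrix.of_apply]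

/-- Outside the volume the Green's function vanishes (junk value). [folklore] -/
theorem greenEntry_of_not (H : SimpleGraph (Site 2)) {Λ : Finset (Site 2)} {a b : Site 2}
    (h : ¬(a ∈ Λ ∧ b ∈ Λ)) : greenEntry H Λ a b = 0 := by
  rw [greenEntry, dif_neg h]

/-- The Green's function of a finite piece of `ℤ²` is nonnegative. [cite: Lawler1991, §1.5] -/
theorem greenEntry_nonneg {H : SimpleGraph (Site 2)} (hH : H ≤ zdGraph 2) (Λ : Finset (Site 2))
    (a b : Site 2) : 0 ≤ greenEntry H Λ a b := by
  by_cases h : a ∈ Λ ∧ b ∈ Λ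
  · rw [greenEntry_eq_tsum hH h.1 h.2]
    exact tsum_nonneg fun n => transition_pow_apply_nonneg H Λ n _ _
  · rw [greenEntry_of_not H h]

/-- The Green's function is symmetric (walk reversal). [cite: Lawler1991, §1.5] -/
theorem greenEntry_comm {H : SimpleGraph (Site 2)} (hH : H ≤ zdGraph 2) (Λ : Finset (Site 2))
    (a b : Site 2) : greenEntry H Λ a b = greenEntry H Λ b a := by
  by_cases h : a ∈ Λ ∧ b ∈ Λ
  · rw [greenEntry_eq_tsum hH h.1 h.2, greenEntry_eq_tsum hH h.2 h.1]
    exact tsum_congr fun n => transition_pow_comm H Λ n _ _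
  · rw [greenEntry_of_not H h, greenEntry_of_not H fun h' => h ⟨h'.2, h'.1⟩]

/-- **Monotonicity in the graph**: deleting edges decreases the Green's function
(`H' ≤ H ≤ ℤ²`). [folklore] -/
theorem greenEntry_mono {H H' : SimpleGraph (Site 2)} (hH : H ≤ zdGraph 2) (hH' : H' ≤ H)
    (Λ : Finset (Site 2)) (a b : Site 2) : greenEntry H' Λ a b ≤ greenEntry H Λ a b := by
  by_cases h : a ∈ Λ ∧ b ∈ Λ
  · rw [greenEntry_eq_tsum (hH'.trans hH) h.1 h.2, greenEntry_eq_tsum hH h.1 h.2]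
    exact Summable.tsum_le_tsum (fun n => transition_pow_apply_mono Λ hH' n _ _)
      (summable_transition_pow_apply Λ (hH'.trans hH) _ _) (summable_transition_pow_apply Λ hH _ _)
  · rw [greenEntry_of_not H' h, greenEntry_of_not H h]

/-- **Positivity**: if `a` and `b` are joined by an `H`-walk inside `Λ`, then
`greenEntry H Λ a b ≥ 4^{-|walk|} > 0`. [cite: Lawler1991, §1.5] -/
theorem greenEntry_pos {H : SimpleGraph (Site 2)} (hH : H ≤ zdGraph 2) {Λ : Finset (Site 2)}
    {a b : Site 2} (p : H.Walk a b) (hp : ∀ v ∈ p.support, v ∈ Λ) : 0 < greenEntry H Λ a b := by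
  have ha : a ∈ Λ := hp a p.start_mem_support
  have hb : b ∈ Λ := hp b p.end_mem_support
  rw [greenEntry_eq_tsum hH ha hb]
  refine lt_of_lt_of_le (by positivity) ((pow_inv_four_le_transition_pow_apply Λ p hp ha hb).trans ?_)
  exact (summable_transition_pow_apply Λ hH _ _).le_tsum p.length fun n _ =>
    transition_pow_apply_nonneg H Λ n _ _

/-- The confined Green's function is at most the unconfined one (`confinedGraph ≤ Ω_δ ≤ ℤ²`).
[folklore] -/
theorem greenEntry_confined_le (Ω S : Set ℂ) (δ : ℝ) (Λ : Finset (Site 2)) (a b : Site 2) :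
    greenEntry (confinedGraph Ω S δ) Λ a b ≤ greenEntry (discreteDomainGraph Ω δ) Λ a b :=
  greenEntry_mono ((discreteDomainGraph_le_meshGraph Ω δ).trans (meshGraph_le_zdGraph Ω δ))
    (confinedGraph_le Ω S δ) Λ a b

/-- `0 ≤ greenRatio`. [folklore] -/
theorem greenRatio_nonneg (Ω S : Set ℂ) (δ : ℝ) (a b : Site 2) : 0 ≤ greenRatio Ω S δ a b :=
  div_nonneg (greenEntry_nonneg (confinedGraph_le_zdGraph Ω S δ) _ a b)
    (greenEntry_nonneg ((discreteDomainGraph_le_meshGraph Ω δ).trans (meshGraph_le_zdGraph Ω δ)) _ a b)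

/-- `greenRatio ≤ 1`: confined walks are a subset of all walks. [folklore] -/
theorem greenRatio_le_one (Ω S : Set ℂ) (δ : ℝ) (a b : Site 2) : greenRatio Ω S δ a b ≤ 1 :=
  div_le_one_of_le₀ (greenEntry_confined_le Ω S δ _ a b)
    (greenEntry_nonneg ((discreteDomainGraph_le_meshGraph Ω δ).trans (meshGraph_le_zdGraph Ω δ)) _ a b)

/-- **Registered closing theorem of this helper file**: the Green's-function ratio of the anchor is a
probability, `greenRatio Ω S δ a b ∈ [0, 1]` — the chance that the killed simple random walk from `a`
to `b` in `Ω_δ` never uses an edge whose segment leaves `closure S`. [folklore] -/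
theorem greenRatio_mem_Icc :
    ∀ (Ω S : Set ℂ) (δ : ℝ) (a b : Site 2), greenRatio Ω S δ a b ∈ Set.Icc (0 : ℝ) 1 :=
  fun Ω S δ a b => ⟨greenRatio_nonneg Ω S δ a b, greenRatio_le_one Ω S δ a b⟩

end Summit.CriticalPhenomena.SAWScalingLimit.Theorems.AvoidanceLimit.Anchor

end
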